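import Summits.BirchSwinnertonDyer.Rank1Residual.GaloisImage.PropagatedConditionStableRange
import Summits.BirchSwinnertonDyer.Rank1Residual.GaloisImage.KolyvaginScalarTransportLocal
import Summits.BirchSwinnertonDyer.Rank1Residual.GaloisImage.TorsionReductionOfLe
import Literature.NumberTheory.EllipticCurves.KummerSequenceConnecting
import HarnessLib

/-!
# [MR04] Prop. A.2 "in general" for `E/ℚ`, `p = 3`, EVERY level, with the depth EXPLICIT:
# `im( H¹(ℚ_v, E[3^{m+1}]) →(3^{m−k}) H¹(ℚ_v, E[3^{k+1}]) ) = 𝓕_can(E[3^{k+1}])_v` for every `m ≥ k + N₀`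
# — THEOREM B of row T-DER at `v = 3` WITHOUT the D7 certificate `E(ℚ₃)[3] = 0`
# (cell `b2b-bsdres`, team n1011, row T-DER-BP; seat n1011-p13 GEN 11; skeleton
# `cells/n1011/skel/T-DER-BP.md` (B)(C))

HONEST FRAMING (cell `b2b-bsdres`, run/shared/lean/b2b/bsd-rank1-residual/, verbatim in every
file): the goal of the cell is to DELETE the COMBINATION-SHAPED residual classes of the
Birch–Swinnerton-Dyer formula for ALL analytic-rank `≤ 1` elliptic curves over `ℚ` — "full BSD
formula for every rank `≤ 1` curve in class `C`" assembled STRICTLY from published theorems — so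
that the rank-`≤ 1` remainder becomes exactly the CONSTRUCTION-SHAPED classes, which are TYPED
(missing-input `Prop`s), NOT attempted. This is not "finishing BSD". Team n1011 (X4 ∧ `p = 3`,
§I N11; row T-DER = Kolyvagin's derivative construction behind the route-1 PORT): research route;
TOOL theorems only; no definition, no named fact, no `sorry`; nothing booked; no mark / label / count
moved; closes nothing by itself.

## What

Row T-DER's THEOREM B at the place `v = 3` (the canonical local condition of the derivative classes)
is in the tree ON THE D7 ROWS ONLY: F11/F12 (`propagatedSelmerStructure_three_eq_top_of_torsion_eq_zero`,
[MR04] Lemma A.1) need `E(ℚ₃)[3] = 0`.  Mazur–Rubin treat the general case by RAISING THE COEFFICIENT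
DEPTH (App. A, Prop. A.2, p. 79 with proof p. 80: "`H¹_𝓕(ℚ_p, T/𝔪^k T)` is the image of `H¹(ℚ_p, T/𝔪^j T)` for all
sufficiently large `j` … hence `κ_n^{(k)} ∈ H¹_{𝓕^n}(ℚ, T/𝔪^k T) ⊗ G_n`"), with NO bound on `j`.
This file proves that statement for `T = T_3E`, `E/ℚ`, at every finite place `v`, at every level,
with `j` EXPLICIT — the cited text asserts the EXISTENCE of such a `j` only; the bound `j = k + N₀`
(`N₀` a `3`-power torsion-stabilisation level of `E(ℚ_v)`) is THIS FILE's and is not in print.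
Notation: `L_k = E[3^k·3]` (`torsionGaloisModule ((3:ℤ)^k * 3)`),
`𝓕_k = 𝓕_can(E[3^k·3])_v = im(H¹(ℚ_v, T_3E) → H¹(ℚ_v, L_k))` (n1011-p13's
`propagatedSelmerStructure W 3 k`), and for `k ≤ m` a "reduction" `r : L_m → L_k` is ANY continuous
equivariant map acting as `3^{m−k}` on points (binder `(r, hr)`, the currency of F12 /
`TorsionLevelDevissageHigher` / n1011-p11's constructor `exists_torsionReduction_three`); `N₀` is a
torsion-stabilisation level of `E(ℚ_v)`: `hstab : ∀ P, 3^(N₀+1) • P = 0 → 3^N₀ • P = 0`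
(`N₀ = 0` is `E(ℚ_v)[3] = 0`).

* `TorsionLevel.isSES_torsionInclusion_redPow` : the short exact sequence
  `0 → L_j →(incl) L_{j+1+k} →(r) L_k → 0` for `r` acting as `3^{j+1}` (kernel `E[3^{j+1}]`; the tree's
  `TorsionLevel.isSES_torsionInclusion_red` is `j = 0`);
* `localMap_eq_localMap_localMap_of_apply_eq` : functoriality of `localMap` in a factorisation
  `f = h ∘ g` given on points;
* `range_localMap_red_eq_propagatedSelmerStructure_three_zero` : the level-`0` case = the sibling's
  `range_localMap_eq_propagatedSelmerStructureOne_of_stable` (`L_0 = E[3]`,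
  `propagatedSelmerStructure W 3 0 = propagatedSelmerStructureOne W 3` definitionally);
* **`range_localMap_red_eq_propagatedSelmerStructure_three`** :
  `(localMap r v).range = propagatedSelmerStructure W 3 k v` for every `m ≥ k + N₀` and every
  reduction `r : L_m → L_k` — induction on `k` with the SAME `N₀`: for `x ∈ H¹(ℚ_v, L_m)`, the
  induction hypothesis on `red_k ∘ r` writes `(red_k)_* r_* x = π_{k+1,*}[η]`; with
  `x₁ = π_{m+1,*}[η]` one has `r_* x₁ = π_{k+2,*}[η] ∈ 𝓕_{k+1}` and `x − x₁ ∈ ker (red_k ∘ r)_* =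
  incl_* H¹(ℚ_v, L_j)` (`j + 1 = m − k`, the new short exact sequence), and
  `r ∘ incl = incl′ ∘ s` with `s : L_j → L_0` acting as `3^j`, so `r_*(x − x₁) = incl′_*(s_* u)`
  with `s_* u ∈ 𝓕_0` by the level-`0` case (`j ≥ N₀`), `= π_{k+2,*}[3^{k+1} η′] ∈ 𝓕_{k+1}`
  (n1011-p11's `Transport.localMap_torsionInclusion_tateLocalMap`);
* `exists_forall_range_localMap_red_eq_propagatedSelmerStructure_three` : the `∃ N₀` form with no
  binder (Mazur–Rubin's statement verbatim, every level);
* `localMap_red_mem_propagatedSelmerStructure_three` : membership form;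
* **`localization_map_red_mem_propagatedSelmerStructure_three`** — THEOREM B AT `v` FOR ANY GLOBAL
  CLASS: for `c ∈ H¹(ℚ, E[3^m·3])` with `m ≥ k + N₀(v)`, `loc_v (r_* c) ∈ 𝓕_can(E[3^k·3])_v`.  No
  Euler-system input and no `E(ℚ₃)[3] = 0`: the derivative class of depth `3^{k+1}` obtained by
  reducing the depth-`3^{m+1}` one (Kolyvagin primes of level `3^{m+1}`, `m = k + N₀`) satisfies the
  canonical condition at `3` on EVERY row (`hstab` is a per-row decidable binder; on X4 rows — additive
  reduction at `3` — one expects `#E(ℚ₃)[3^∞] ≤ 9`, i.e. `N₀ ≤ 2`; that bound is NOT proved in this file).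

EVERY FINITE PLACE.  All statements hold at an arbitrary finite place `v` of `ℚ`, not only at `3`:
at a BAD place `w ≠ 3` with `E(ℚ_w)[3] ≠ 0` (the "anomalous bad" places of ROUTE-1 §45.4) the same
depth-raising gives row T-DER's bad-place target `loc_w ∈ im(H¹(ℚ_w, T_3E) → H¹(ℚ_w, E[3^k·3]))`
(= `propagatedSelmerStructure W 3 k (inr w)`) for REDUCED classes of depth `≥ k + N₀(w)` — a road
beside the TOWER form (T-DER-BN) and the `hord` form, paid for in the depth of the Kolyvagin primes;
at a good `w ∤ 3` with `E(ℚ_w)[3] = 0` everything is vacuous (`H¹(ℚ_w, E[3^k·3]) = 0`, F10).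

References: B. Mazur, K. Rubin, *Kolyvagin systems*, Mem. AMS 168/799 (2004), App. A, Lemma A.1,
Prop. A.2 (pp. 79–80), Thm. 3.2.4 [MazurRubin2004]; K. Rubin, *Euler Systems* (2000) Thm. 4.5.1
(no condition at `p`); K. Rubin, PCMS 18 (2011) §3.1 [Rubin2011]; J. S. Milne, *ADT* I §6
[MilneADT2006]; J.-P. Serre, *Galois Cohomology* I §2.2 [SerreGaloisCohomology1997].
-/

noncomputable section

open scoped Classical NumberField ContRepresentation
open Field NumberField IsDedekindDomain Function
open WeierstrassCurve Literature.NumberTheory.EllipticCurves Literature.NumberTheory.GaloisRepresentations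
  Literature.NumberTheory.GaloisRepresentations.DiscreteGaloisModule Literature.NumberTheory.GaloisCohomology

universe u
namespace Summit.BirchSwinnertonDyer.Rank1Residual.GaloisImage

/-! ### §0. Functoriality of `localMap` along a pointwise factorisation -/

section Functoriality

variable {K : Type u} [Field K] [NumberField K] {M₁ M₂ M₃ : Type u}
  [AddCommGroup M₁] [TopologicalSpace M₁] [DiscreteTopology M₁]
  [AddCommGroup M₂] [TopologicalSpace M₂] [DiscreteTopology M₂]
  [AddCommGroup M₃] [TopologicalSpace M₃] [DiscreteTopology M₃]
  {ρ₁ : DiscreteGaloisModule K M₁} {ρ₂ : DiscreteGaloisModule K M₂} {ρ₃ : DiscreteGaloisModule K M₃}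

/-- **`f_* = h_* ∘ g_*` on `H¹(K_v, ·)` when `f = h ∘ g` on points** (functoriality of the local maps
in the equivariant map; on crossed homomorphisms both sides are `σ ↦ f (φ σ) = h (g (φ σ))`).
[cite: SerreGaloisCohomology1997, I §2.2] -/
theorem localMap_eq_localMap_localMap_of_apply_eq
    (f : ρ₁.toContRepresentation →ⁱL ρ₃.toContRepresentation)
    (g : ρ₁.toContRepresentation →ⁱL ρ₂.toContRepresentation)
    (h : ρ₂.toContRepresentation →ⁱL ρ₃.toContRepresentation)
    (hfgh : ∀ x, f x = h (g x)) (v : Place K) (y : galoisCohomology (ρ₁.toLocal v) 1) :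
    DiscreteGaloisModule.localMap f v y =
      DiscreteGaloisModule.localMap h v (DiscreteGaloisModule.localMap g v y) := by
  obtain ⟨φ, rfl⟩ := oneCocycleClass_surjective (ρ₁.toLocal v).toTopRep y
  erw [galoisCohomology.map_one_oneCocycleClass, galoisCohomology.map_one_oneCocycleClass,
    galoisCohomology.map_one_oneCocycleClass]
  refine congrArg _ (Subtype.ext (ContinuousMap.ext fun σ => ?_))
  exact hfgh _

end Functoriality
/-! ### §1. The short exact sequence `0 → E[3^j·3] → E[3^{j+1+k}·3] →(3^{j+1}) E[3^k·3] → 0` -/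

namespace TorsionLevel

variable (W : WeierstrassCurve ℚ) (j k : ℕ)
  (r : (W.torsionGaloisModule (((3 : ℕ) : ℤ) ^ (j + 1 + k) * ((3 : ℕ) : ℤ))).toContRepresentation →ⁱL
    (W.torsionGaloisModule (((3 : ℕ) : ℤ) ^ k * ((3 : ℕ) : ℤ))).toContRepresentation)
  (hr : ∀ x : geomTorsion W (((3 : ℕ) : ℤ) ^ (j + 1 + k) * ((3 : ℕ) : ℤ)),
    ((r x : geomTorsion W (((3 : ℕ) : ℤ) ^ k * ((3 : ℕ) : ℤ))) : geomPoints W) =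
      (((3 : ℕ) : ℤ) ^ (j + 1)) • (x : geomPoints W))

/-- `3^j·3 ∣ 3^{j+1+k}·3` in `ℤ` (the inclusion `E[3^j·3] ⊆ E[3^{j+1+k}·3]`). [folklore] -/
theorem pow_mul_dvd_pow_add_mul :
    (((3 : ℕ) : ℤ) ^ j * ((3 : ℕ) : ℤ)) ∣ (((3 : ℕ) : ℤ) ^ (j + 1 + k) * ((3 : ℕ) : ℤ)) :=
  Transport.pow_mul_dvd_pow_mul (show j ≤ j + 1 + k by omega)

include hr in
/-- **`0 → E[3^j·3] →(incl) E[3^{j+1+k}·3] →(r) E[3^k·3] → 0` is a short exact sequence of discrete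
`Γ_ℚ`-modules** for any equivariant `r` which is `x ↦ 3^{j+1} x` on points (kernel `E[3^{j+1}]`;
surjectivity = divisibility of `E(ℚ̄)`); Milne's `0 → A_m → A_{mn} →ᵐ A_n → 0`.  The tree's
`TorsionLevel.isSES_torsionInclusion_red` is the case `j = 0`. [cite: MilneADT2006, Ch. I §6, proof of Prop. 6.9] -/
theorem isSES_torsionInclusion_redPow :
    IsSES (DiscreteGaloisModule.homOfIntertwining (W.torsionInclusion (pow_mul_dvd_pow_add_mul j k)))
      (DiscreteGaloisModule.homOfIntertwining r) where
  comp_eq_zero := by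
    ext P
    have h := (mem_geomTorsion_iff W (((3 : ℕ) : ℤ) ^ j * ((3 : ℕ) : ℤ)) _).mp P.2
    change ((r (W.torsionInclusion (pow_mul_dvd_pow_add_mul j k) P) :
      geomTorsion W (((3 : ℕ) : ℤ) ^ k * ((3 : ℕ) : ℤ))) : geomPoints W) = 0
    rw [hr, coe_torsionInclusion_apply, pow_succ]
    exact h
  injective := fun P Q h => Subtype.ext (congrArg Subtype.val h :)
  exact_mid := fun P hP => by
    have hP' : (((3 : ℕ) : ℤ) ^ j * ((3 : ℕ) : ℤ)) • (P : geomPoints W) = 0 := by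
      rw [← pow_succ, ← hr]
      exact congrArg Subtype.val hP
    exact ⟨⟨P, (mem_geomTorsion_iff W _ _).mpr hP'⟩, rfl⟩
  surjective := fun Q => by
    have h3 : (((3 : ℕ) : ℤ) ^ (j + 1)) ≠ 0 := pow_ne_zero _ (by norm_num)
    obtain ⟨P, hP⟩ := W.zsmul_geomPoints_surjective_of_charZero h3 (Q : geomPoints W)
    have hP' : (((3 : ℕ) : ℤ) ^ (j + 1)) • P = (Q : geomPoints W) := hP
    have hPmem : P ∈ geomTorsion W (((3 : ℕ) : ℤ) ^ (j + 1 + k) * ((3 : ℕ) : ℤ)) := by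
      rw [mem_geomTorsion_iff,
        show ((3 : ℕ) : ℤ) ^ (j + 1 + k) * ((3 : ℕ) : ℤ) =
          (((3 : ℕ) : ℤ) ^ k * ((3 : ℕ) : ℤ)) * ((3 : ℕ) : ℤ) ^ (j + 1) by ring,
        mul_zsmul, hP']
      exact (mem_geomTorsion_iff W _ _).mp Q.2
    refine ⟨⟨P, hPmem⟩, Subtype.ext ?_⟩
    change ((r ⟨P, hPmem⟩ : geomTorsion W (((3 : ℕ) : ℤ) ^ k * ((3 : ℕ) : ℤ))) : geomPoints W) =
      (Q : geomPoints W)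
    rw [hr]
    exact hP'

end TorsionLevel
/-! ### §2. Level `0`: `im( H¹(ℚ_v, E[3^m·3]) →(3^m) H¹(ℚ_v, E[3^0·3]) ) = 𝓕_can(E[3^0·3])_v` for `m ≥ N₀` -/

variable (W : WeierstrassCurve ℚ) [W.IsElliptic] (v : HeightOneSpectrum (𝓞 ℚ))

/-- **Level `0`** (`L_0 = E[3^0·3] = E[3]` and `propagatedSelmerStructure W 3 0 = propagatedSelmerStructureOne W 3`
definitionally, n1011-p13's `propagatedSelmerStructure_three_zero`): for `m ≥ N₀` and any reduction
`r : E[3^m·3] → E[3^0·3]` (`x ↦ 3^m x`), `im r_* = 𝓕_can(E[3^0·3])_v` — the sibling's level-one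
stabilisation `range_localMap_eq_propagatedSelmerStructureOne_of_stable` (a map acting as `3^m` IS
`torsionMulBy (3^m) 3`, the sibling's stated extensionality `eq_torsionMulBy_of_apply_eq`).  Existence
of such a level: Mazur–Rubin, Prop. A.2 (p. 79, proof p. 80); the explicit level `N₀` is this file's, not in print.
[cite: MazurRubin2004, App. A, Prop. A.2 (p. 79) and its proof (p. 80)] -/
theorem range_localMap_red_eq_propagatedSelmerStructure_three_zero {N₀ : ℕ}
    (hstab : ∀ P : (W.baseChange (v.adicCompletion ℚ)).toAffine.Point,
      3 ^ (N₀ + 1) • P = 0 → 3 ^ N₀ • P = 0)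
    (m : ℕ) (hm : N₀ ≤ m)
    (r : (W.torsionGaloisModule (((3 : ℕ) : ℤ) ^ m * ((3 : ℕ) : ℤ))).toContRepresentation →ⁱL
      (W.torsionGaloisModule (((3 : ℕ) : ℤ) ^ 0 * ((3 : ℕ) : ℤ))).toContRepresentation)
    (hr : ∀ x : geomTorsion W (((3 : ℕ) : ℤ) ^ m * ((3 : ℕ) : ℤ)),
      ((r x : geomTorsion W (((3 : ℕ) : ℤ) ^ 0 * ((3 : ℕ) : ℤ))) : geomPoints W) =
        (((3 : ℕ) : ℤ) ^ (m - 0)) • (x : geomPoints W)) :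
    haveI : Fact (Nat.Prime 3) := ⟨Nat.prime_three⟩
    (DiscreteGaloisModule.localMap r (Sum.inr v : Place ℚ)).range =
      propagatedSelmerStructure W 3 0 (Sum.inr v) := by
  haveI : Fact (Nat.Prime 3) := ⟨Nat.prime_three⟩
  have hr' : ∀ x : geomTorsion W (((3 : ℕ) : ℤ) ^ m * ((3 : ℕ) : ℤ)),
      (((r : (W.torsionGaloisModule (((3 : ℕ) : ℤ) ^ m * ((3 : ℕ) : ℤ))).toContRepresentation →ⁱL
          (W.torsionGaloisModule ((3 : ℕ) : ℤ)).toContRepresentation) x :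
        geomTorsion W ((3 : ℕ) : ℤ)) : geomPoints W) =
        (((3 : ℕ) : ℤ) ^ m) • (x : geomPoints W) := fun x => by
    have h := hr x
    rw [Nat.sub_zero] at h
    exact h
  exact range_localMap_eq_propagatedSelmerStructureOne_of_stable W 3 v hstab m hm _ hr'

/-! ### §3. Every level: induction on `k` with the same `N₀` -/

/-- **`im( H¹(ℚ_v, E[3^m·3]) →(3^{m−k}) H¹(ℚ_v, E[3^k·3]) ) = 𝓕_can(E[3^k·3])_v` for every
`m ≥ k + N₀` and every reduction `r`** — [MR04] Prop. A.2's "for all sufficiently large `j`"; the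
cited text asserts EXISTENCE only, the bound `j = k + N₀` (`N₀` a `3`-power torsion-stabilisation level
of `E(ℚ_v)`, displayed binder `hstab`) is THIS FILE's (module docstring for the induction).  `N₀ = 0`
(`E(ℚ_v)[3] = 0`) with `m = k` is F12's `𝓕_can(E[3^k·3])_v = ⊤`.
[cite: MazurRubin2004, App. A, Prop. A.2 (p. 79) and its proof (p. 80)] -/
theorem range_localMap_red_eq_propagatedSelmerStructure_three {N₀ : ℕ}
    (hstab : ∀ P : (W.baseChange (v.adicCompletion ℚ)).toAffine.Point,
      3 ^ (N₀ + 1) • P = 0 → 3 ^ N₀ • P = 0)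
    (k m : ℕ) (hkm : k + N₀ ≤ m)
    (r : (W.torsionGaloisModule (((3 : ℕ) : ℤ) ^ m * ((3 : ℕ) : ℤ))).toContRepresentation →ⁱL
      (W.torsionGaloisModule (((3 : ℕ) : ℤ) ^ k * ((3 : ℕ) : ℤ))).toContRepresentation)
    (hr : ∀ x : geomTorsion W (((3 : ℕ) : ℤ) ^ m * ((3 : ℕ) : ℤ)),
      ((r x : geomTorsion W (((3 : ℕ) : ℤ) ^ k * ((3 : ℕ) : ℤ))) : geomPoints W) =
        (((3 : ℕ) : ℤ) ^ (m - k)) • (x : geomPoints W)) :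
    haveI : Fact (Nat.Prime 3) := ⟨Nat.prime_three⟩
    (DiscreteGaloisModule.localMap r (Sum.inr v : Place ℚ)).range =
      propagatedSelmerStructure W 3 k (Sum.inr v) := by
  haveI : Fact (Nat.Prime 3) := ⟨Nat.prime_three⟩
  induction k generalizing m with
  | zero =>
    exact range_localMap_red_eq_propagatedSelmerStructure_three_zero W v hstab m (by omega) r hr
  | succ k ih =>
    -- write `m = j + 1 + k` with `j ≥ N₀`
    obtain ⟨j, rfl⟩ : ∃ j, m = j + 1 + k := ⟨m - (k + 1), by omega⟩
    have hjN : N₀ ≤ j := by omega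
    set V : Place ℚ := Sum.inr v with hV
    refine le_antisymm ?_ ?_
    swap
    · -- `𝓕_{k+1} ≤ im r_*`: `π_{k+2,*}[η] = r_* π_{m+1,*}[η]`
      intro z hz
      obtain ⟨y, hy⟩ := (mem_propagatedSelmerStructure_iff W 3 (k + 1) V _).mp hz
      obtain ⟨η, rfl⟩ := oneCocycleClass_surjective (tateLocalRep W 3 V).toTopRep y
      refine ⟨tateLocalMap W 3 (j + 1 + k) V (oneCocycleClass (tateLocalRep W 3 V).toTopRep η), ?_⟩
      rw [← hy]
      exact Transport.localMap_red_tateLocalMap W (show k + 1 ≤ j + 1 + k by omega) r hr V η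
    · rintro _ ⟨x, rfl⟩
      -- the one-step reduction `red_k : L_{k+1} → L_k` and `r' = red_k ∘ r`
      obtain ⟨redk, hredk⟩ := exists_torsionReduction_three W k (k + 1)
      have hredk1 : ∀ y : geomTorsion W (((3 : ℕ) : ℤ) ^ (k + 1) * ((3 : ℕ) : ℤ)),
          ((redk y : geomTorsion W (((3 : ℕ) : ℤ) ^ k * ((3 : ℕ) : ℤ))) : geomPoints W) =
            ((3 : ℕ) : ℤ) • (y : geomPoints W) := fun y => by
        rw [hredk, Nat.add_sub_cancel_left, pow_one]
      set r' := redk.comp r with hr'def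
      have hr' : ∀ x : geomTorsion W (((3 : ℕ) : ℤ) ^ (j + 1 + k) * ((3 : ℕ) : ℤ)),
          ((r' x : geomTorsion W (((3 : ℕ) : ℤ) ^ k * ((3 : ℕ) : ℤ))) : geomPoints W) =
            (((3 : ℕ) : ℤ) ^ (j + 1 + k - k)) • (x : geomPoints W) := fun x => by
        change ((redk (r x) : geomTorsion W (((3 : ℕ) : ℤ) ^ k * ((3 : ℕ) : ℤ))) : geomPoints W) = _
        rw [hredk1, hr, smul_smul, ← pow_succ']
        congr 2
        omega
      -- induction hypothesis for `r'`: `r'_* x ∈ 𝓕_k`, `r'_* x = π_{k+1,*}[η]`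
      have hx' : DiscreteGaloisModule.localMap r' V x ∈ propagatedSelmerStructure W 3 k V := by
        rw [← ih (j + 1 + k) (by omega) r' hr']
        exact ⟨x, rfl⟩
      obtain ⟨y, hy⟩ := (mem_propagatedSelmerStructure_iff W 3 k V _).mp hx'
      obtain ⟨η, rfl⟩ := oneCocycleClass_surjective (tateLocalRep W 3 V).toTopRep y
      -- `x₁ = π_{m+1,*}[η]`: `r_* x₁ = π_{k+2,*}[η]`, `r'_* x₁ = π_{k+1,*}[η]`
      set x₁ := tateLocalMap W 3 (j + 1 + k) V (oneCocycleClass (tateLocalRep W 3 V).toTopRep η) with hx₁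
      have hrx₁ : DiscreteGaloisModule.localMap r V x₁ =
          tateLocalMap W 3 (k + 1) V (oneCocycleClass (tateLocalRep W 3 V).toTopRep η) :=
        Transport.localMap_red_tateLocalMap W (show k + 1 ≤ j + 1 + k by omega) r hr V η
      have hr'x₁ : DiscreteGaloisModule.localMap r' V x₁ =
          tateLocalMap W 3 k V (oneCocycleClass (tateLocalRep W 3 V).toTopRep η) :=
        Transport.localMap_red_tateLocalMap W (show k ≤ j + 1 + k by omega) r' hr' V η
      -- `x - x₁ ∈ ker r'_* = incl_* H¹(ℚ_v, L_j)`
      have hdiff : DiscreteGaloisModule.localMap r' V (x - x₁) = 0 := by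
        rw [map_sub, hr'x₁, hy, sub_self]
      have hr'' : ∀ x : geomTorsion W (((3 : ℕ) : ℤ) ^ (j + 1 + k) * ((3 : ℕ) : ℤ)),
          ((r' x : geomTorsion W (((3 : ℕ) : ℤ) ^ k * ((3 : ℕ) : ℤ))) : geomPoints W) =
            (((3 : ℕ) : ℤ) ^ (j + 1)) • (x : geomPoints W) := fun x => by
        rw [hr', show j + 1 + k - k = j + 1 by omega]
      have hSES := (TorsionLevel.isSES_torsionInclusion_redPow W j k r' hr'').restrictField
        (Place.Completion V)
      obtain ⟨u, hu⟩ := hSES.exists_map_one_eq_of_map_one_eq_zero (x - x₁) hdiff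
      have hu' : DiscreteGaloisModule.localMap
          (W.torsionInclusion (TorsionLevel.pow_mul_dvd_pow_add_mul j k)) V u =
            x - x₁ := hu
      -- `s : L_j → L_0`, `x ↦ 3^j x`; `r ∘ incl = incl' ∘ s` on points
      obtain ⟨s, hs⟩ := exists_torsionReduction_three W 0 j
      have hfact : ∀ y : geomTorsion W (((3 : ℕ) : ℤ) ^ j * ((3 : ℕ) : ℤ)),
          (r.comp (W.torsionInclusion (TorsionLevel.pow_mul_dvd_pow_add_mul j k))) y =
            (W.torsionInclusion (Transport.pow_mul_dvd_pow_mul (Nat.zero_le (k + 1)))) (s y) := by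
        intro y
        apply Subtype.ext
        change ((r (W.torsionInclusion _ y) :
          geomTorsion W (((3 : ℕ) : ℤ) ^ (k + 1) * ((3 : ℕ) : ℤ))) : geomPoints W) =
          ((W.torsionInclusion _ (s y) :
            geomTorsion W (((3 : ℕ) : ℤ) ^ (k + 1) * ((3 : ℕ) : ℤ))) : geomPoints W)
        rw [hr, coe_torsionInclusion_apply, coe_torsionInclusion_apply, hs, Nat.sub_zero,
          show j + 1 + k - (k + 1) = j by omega]
      have hcomp₁ := localMap_eq_localMap_localMap_of_apply_eq
        (r.comp (W.torsionInclusion (TorsionLevel.pow_mul_dvd_pow_add_mul j k)))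
        (W.torsionInclusion (TorsionLevel.pow_mul_dvd_pow_add_mul j k)) r
        (fun _ => rfl) V u
      have hcomp₂ := localMap_eq_localMap_localMap_of_apply_eq
        (r.comp (W.torsionInclusion (TorsionLevel.pow_mul_dvd_pow_add_mul j k)))
        s (W.torsionInclusion (Transport.pow_mul_dvd_pow_mul (Nat.zero_le (k + 1)))) hfact V u
      -- `s_* u ∈ 𝓕_0` by the level-`0` case (`j ≥ N₀`): `s_* u = π_{1,*}[η']`
      have hsu : DiscreteGaloisModule.localMap s V u ∈ propagatedSelmerStructure W 3 0 V := by
        rw [← range_localMap_red_eq_propagatedSelmerStructure_three_zero W v hstab j hjN s hs]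
        exact ⟨u, rfl⟩
      obtain ⟨y', hy'⟩ := (mem_propagatedSelmerStructure_iff W 3 0 V _).mp hsu
      obtain ⟨η', rfl⟩ := oneCocycleClass_surjective (tateLocalRep W 3 V).toTopRep y'
      have hincl := Transport.localMap_torsionInclusion_tateLocalMap W (Nat.zero_le (k + 1)) V η'
      -- assemble: `r_* x = r_* x₁ + incl'_* (s_* u)`
      have hxeq : DiscreteGaloisModule.localMap r V x =
          tateLocalMap W 3 (k + 1) V (oneCocycleClass (tateLocalRep W 3 V).toTopRep η) +
            tateLocalMap W 3 (k + 1) V (oneCocycleClass (tateLocalRep W 3 V).toTopRep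
              ((((3 ^ (k + 1 - 0) : ℕ)) : ℤ) • η')) := by
        rw [← hincl, hy', ← hcomp₂, hcomp₁, hu', map_sub, hrx₁, add_sub_cancel]
      rw [hxeq]
      exact add_mem ((mem_propagatedSelmerStructure_iff W 3 (k + 1) V _).mpr ⟨_, rfl⟩)
        ((mem_propagatedSelmerStructure_iff W 3 (k + 1) V _).mpr ⟨_, rfl⟩)

/-- **Mazur–Rubin's statement verbatim, every level, no binder**: there is `N₀` (a `3`-power
torsion-stabilisation level of `E(ℚ_v)`, which exists since that torsion is finite — the sibling's
`exists_torsion_stable`) such that `im r_* = 𝓕_can(E[3^k·3])_v` for every `k`, every `m ≥ k + N₀` and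
every reduction `r : E[3^m·3] → E[3^k·3]` — "`H¹_𝓕(ℚ_p, T/𝔪^k T)` is the image of `H¹(ℚ_p, T/𝔪^j T)`
for all sufficiently large `j`". [cite: MazurRubin2004, App. A, Prop. A.2 (p. 79) and its proof (p. 80)] -/
theorem exists_forall_range_localMap_red_eq_propagatedSelmerStructure_three :
    ∃ N₀ : ℕ, ∀ k m : ℕ, k + N₀ ≤ m →
      ∀ (r : (W.torsionGaloisModule (((3 : ℕ) : ℤ) ^ m * ((3 : ℕ) : ℤ))).toContRepresentation →ⁱL
          (W.torsionGaloisModule (((3 : ℕ) : ℤ) ^ k * ((3 : ℕ) : ℤ))).toContRepresentation),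
        (∀ x : geomTorsion W (((3 : ℕ) : ℤ) ^ m * ((3 : ℕ) : ℤ)),
          ((r x : geomTorsion W (((3 : ℕ) : ℤ) ^ k * ((3 : ℕ) : ℤ))) : geomPoints W) =
            (((3 : ℕ) : ℤ) ^ (m - k)) • (x : geomPoints W)) →
        haveI : Fact (Nat.Prime 3) := ⟨Nat.prime_three⟩
        (DiscreteGaloisModule.localMap r (Sum.inr v : Place ℚ)).range =
          propagatedSelmerStructure W 3 k (Sum.inr v) := by
  haveI : Fact (Nat.Prime 3) := ⟨Nat.prime_three⟩
  obtain ⟨N₀, hstab⟩ := exists_torsion_stable W 3 v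
  exact ⟨N₀, fun k m hkm r hr =>
    range_localMap_red_eq_propagatedSelmerStructure_three W v hstab k m hkm r hr⟩

/-- **Membership form**: for `m ≥ k + N₀`, EVERY class of `H¹(ℚ_v, E[3^m·3])` reduces into
`𝓕_can(E[3^k·3])_v` (existence of such an `m`: Mazur–Rubin, Prop. A.2 pp. 79–80; the bound is this
file's). [cite: MazurRubin2004, App. A, Prop. A.2 (p. 79) and its proof (p. 80)] -/
theorem localMap_red_mem_propagatedSelmerStructure_three {N₀ : ℕ}
    (hstab : ∀ P : (W.baseChange (v.adicCompletion ℚ)).toAffine.Point,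
      3 ^ (N₀ + 1) • P = 0 → 3 ^ N₀ • P = 0)
    (k m : ℕ) (hkm : k + N₀ ≤ m)
    (r : (W.torsionGaloisModule (((3 : ℕ) : ℤ) ^ m * ((3 : ℕ) : ℤ))).toContRepresentation →ⁱL
      (W.torsionGaloisModule (((3 : ℕ) : ℤ) ^ k * ((3 : ℕ) : ℤ))).toContRepresentation)
    (hr : ∀ x : geomTorsion W (((3 : ℕ) : ℤ) ^ m * ((3 : ℕ) : ℤ)),
      ((r x : geomTorsion W (((3 : ℕ) : ℤ) ^ k * ((3 : ℕ) : ℤ))) : geomPoints W) =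
        (((3 : ℕ) : ℤ) ^ (m - k)) • (x : geomPoints W))
    (y : galoisCohomology ((W.torsionGaloisModule (((3 : ℕ) : ℤ) ^ m * ((3 : ℕ) : ℤ))).toLocal
      (Sum.inr v : Place ℚ)) 1) :
    haveI : Fact (Nat.Prime 3) := ⟨Nat.prime_three⟩
    DiscreteGaloisModule.localMap r (Sum.inr v : Place ℚ) y ∈ propagatedSelmerStructure W 3 k (Sum.inr v) := by
  haveI : Fact (Nat.Prime 3) := ⟨Nat.prime_three⟩
  rw [← range_localMap_red_eq_propagatedSelmerStructure_three W v hstab k m hkm r hr]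
  exact ⟨y, rfl⟩

/-! ### §4. THEOREM B at `v` for any global class -/

/-- **THEOREM B of row T-DER at the place `v` (in particular `v = 3`), `E(ℚ_v)[3] ≠ 0` allowed**: for
every global class `c ∈ H¹(ℚ, E[3^m·3])` with `m ≥ k + N₀(v)` and every reduction
`r : E[3^m·3] → E[3^k·3]`, the localisation of `r_* c` at `v` satisfies the canonical (propagated)
local condition: `loc_v (r_* c) ∈ 𝓕_can(E[3^k·3])_v`.  Mazur–Rubin, proof of Prop. A.2: "if
`n ∈ 𝒩_j` then `I_n ⊂ 𝔪^j` so `κ_n^{(k)}` is in the image of `H¹(ℚ, T/𝔪^j T) ⊗ G_n`, and hence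
`κ_n^{(k)} ∈ H¹_{𝓕^n}(ℚ, T/𝔪^k T) ⊗ G_n`" — here for ANY global class, with the bound `j = k + N₀`
that is THIS FILE's (the cited text asserts existence of `j` only).  NOT claimed here (the T-DER side,
n1011-p11/p15): that Kolyvagin's derivative class of depth `3^{k+1}` IS the reduction of the
depth-`3^{m+1}` one on `n ∈ 𝒩_{m+1}` (F4 `Derivative.existsUnique_res_eq_deriv`), and every other
clause of THEOREM B. [cite: MazurRubin2004, App. A, Prop. A.2 (p. 79) and its proof (p. 80)] -/
theorem localization_map_red_mem_propagatedSelmerStructure_three {N₀ : ℕ}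
    (hstab : ∀ P : (W.baseChange (v.adicCompletion ℚ)).toAffine.Point,
      3 ^ (N₀ + 1) • P = 0 → 3 ^ N₀ • P = 0)
    (k m : ℕ) (hkm : k + N₀ ≤ m)
    (r : (W.torsionGaloisModule (((3 : ℕ) : ℤ) ^ m * ((3 : ℕ) : ℤ))).toContRepresentation →ⁱL
      (W.torsionGaloisModule (((3 : ℕ) : ℤ) ^ k * ((3 : ℕ) : ℤ))).toContRepresentation)
    (hr : ∀ x : geomTorsion W (((3 : ℕ) : ℤ) ^ m * ((3 : ℕ) : ℤ)),
      ((r x : geomTorsion W (((3 : ℕ) : ℤ) ^ k * ((3 : ℕ) : ℤ))) : geomPoints W) =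
        (((3 : ℕ) : ℤ) ^ (m - k)) • (x : geomPoints W))
    (c : galoisCohomology (W.torsionGaloisModule (((3 : ℕ) : ℤ) ^ m * ((3 : ℕ) : ℤ))) 1) :
    haveI : Fact (Nat.Prime 3) := ⟨Nat.prime_three⟩
    galoisCohomology.localization (W.torsionGaloisModule (((3 : ℕ) : ℤ) ^ k * ((3 : ℕ) : ℤ)))
        (Sum.inr v : Place ℚ) 1 (galoisCohomology.map r 1 c) ∈
      propagatedSelmerStructure W 3 k (Sum.inr v) := by
  haveI : Fact (Nat.Prime 3) := ⟨Nat.prime_three⟩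
  change galoisCohomology.res _ (Place.Completion (Sum.inr v : Place ℚ)) 1 (galoisCohomology.map r 1 c) ∈ _
  rw [galoisCohomology.res_map_one]
  exact localMap_red_mem_propagatedSelmerStructure_three W v hstab k m hkm r hr _

end Summit.BirchSwinnertonDyer.Rank1Residual.GaloisImage

end
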